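import Literature.NumberTheory.LFunctions.FeketePolyaKernelCertificatesBlockWrappers
import HarnessLib

/-!
# No real zero for real primitive characters of conductor `15060 ≤ q ≤ 15892`: the Fekete–Pólya rows, in the kernel (rows deferred by the earlier engines)

Topic `Literature/NumberTheory/LFunctions`; namespace `Literature.NumberTheory.LFunctions`. THEOREMS only (no
definition, no named fact, no `sorry`; standard axioms): one PUBLIC theorem **`noRealZero{Odd,Even}_fp_<q>`** per
fundamental discriminant `D`, `|D| = q ∈ [15060, 15892]`, that admits a Fekete–Pólya witness but was DEFERRED by the per-position engines v1/v2 (walk too long for one `decide`) — for every primitive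
quadratic `χ` mod `q` of the parity of `D` and every `σ ∈ (0, 1)`, `L(σ, χ) ≠ 0` (statement shape of the
`interval_cases` bullets of the `NoRealZero{Odd,Even}…` range files, so a range assembly cites them by name).
Cell `parity-realchar`, kernel floor of the wide column (TARGET §2 row 19), Fekete–Pólya lane (seat prover-2).

Method (engine v4): `FeketePolyaKernelCertificatesBlock{,Wrappers}.lean` — the iterated partial sums of order
`K` of the induced character `χ↑(q·w)` are non-negative over one period, decided in the kernel BLOCKWISE on packed
base-`2^b` digits (`blockCert b B K (q·w) (tabs… b ps q w)`: sign tables of the character from the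
quadratic-residue bitsets of the prime factors of the conductor — the factor list is part of each certificate,
primality by `norm_num` — prefix sums by one big-integer multiplication per order and block, sign test by one
AND), hence `ℜL(σ, χ↑(q·w)) > 0` (Fekete–Pólya 1912 / MV §11.2.1 Exercise 7) and `L(σ, χ) ≠ 0` (positive Euler
factors, Exercise 8).  Witnesses `(w, K)` = the cheapest in the exact integer scan of this seat
(`HOME/parity-realchar-prover-2/fp-witnesses-*.tsv`; no kit); the digit width `b` is two bits above the size of
the running-sum bound recorded by the scan.  11 characters in this file (est. 78 kernel-s).
NOT covered here (no Fekete–Pólya witness with `w ≤ 40`, `q·w ≤ 4·10⁵`, `K ≤ 12`; the other Fekete–Pólya rows of this range are in the `NoRealZeroFeketePolyaX…` files) — left to the truncation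
certificates of the companion lane: see those files.

## References

* H. L. Montgomery, R. C. Vaughan, *Multiplicative Number Theory I*, CUP 2007, §9.3 Thm 9.13, §11.2.1
  Exercises 7–8. [MontgomeryVaughan2007]
* M. Fekete, G. Pólya, *Über ein Problem von Laguerre*, Rend. Circ. Mat. Palermo 34 (1912) 89–120. [FeketePolya1912]
-/

namespace Literature.NumberTheory.LFunctions

open FeketePolyaKernel

set_option maxHeartbeats 400000 in
/-- `D = -15060`: the odd character `χ₋₄·(·/3765)` of conductor `15060` (`3765`: 3 · 5 · 251) — Fekete–Pólya witness of order `3` along the induced modulus `15060·11 = 165660`, block certificate (digits of `43` bits, splitting depth `9`); est. `1.6` kernel-s. [cite: MontgomeryVaughan2007, §11.2.1 Exercises 7 (g), 8] -/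
theorem noRealZeroOdd_fp_15060 :
    ∀ χ : DirichletCharacter ℂ 15060, χ.IsQuadratic → χ.IsPrimitive → χ.Odd →
      ∀ σ : ℝ, 0 < σ → σ < 1 → χ.LFunction σ ≠ 0 :=
  good_odd_of_four_blk [3, 5, 251] (by norm_num) (by decide) (by decide) 11 3 43 9 (by decide) (by decide) (by decide)
    (Or.inr (by decide +kernel))

set_option maxHeartbeats 400000 in
/-- `D = 15373`: the even character `(·/15373)` of conductor `15373` (`15373`: prime) — Fekete–Pólya witness of order `8` along the induced modulus `15373·11 = 169103`, block certificate (digits of `116` bits, splitting depth `10`); est. `8.2` kernel-s. [cite: MontgomeryVaughan2007, §11.2.1 Exercises 7 (g), 8] -/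
theorem noRealZeroEven_fp_15373 :
    ∀ χ : DirichletCharacter ℂ 15373, χ.IsQuadratic → χ.IsPrimitive → χ.Even →
      ∀ σ : ℝ, 0 < σ → σ < 1 → χ.LFunction σ ≠ 0 :=
  good_even_of_odd_blk [15373] (by norm_num) (by decide) (by decide) 11 8 116 10 (by decide) (by decide) (by decide)
    (Or.inr (by decide +kernel))

set_option maxHeartbeats 400000 in
/-- `D = -15412`: the odd character `χ₋₄·(·/3853)` of conductor `15412` (`3853`: prime) — Fekete–Pólya witness of order `3` along the induced modulus `15412·15 = 231180`, block certificate (digits of `44` bits, splitting depth `9`); est. `2.4` kernel-s. [cite: MontgomeryVaughan2007, §11.2.1 Exercises 7 (g), 8] -/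
theorem noRealZeroOdd_fp_15412 :
    ∀ χ : DirichletCharacter ℂ 15412, χ.IsQuadratic → χ.IsPrimitive → χ.Odd →
      ∀ σ : ℝ, 0 < σ → σ < 1 → χ.LFunction σ ≠ 0 :=
  good_odd_of_four_blk [3853] (by norm_num) (by decide) (by decide) 15 3 44 9 (by decide) (by decide) (by decide)
    (Or.inr (by decide +kernel))

set_option maxHeartbeats 400000 in
/-- `D = 15452`: the even character `χ₋₄·(·/3863)` of conductor `15452` (`3863`: prime) — Fekete–Pólya witness of order `6` along the induced modulus `15452·15 = 231780`, block certificate (digits of `90` bits, splitting depth `10`); est. `7.0` kernel-s. [cite: MontgomeryVaughan2007, §11.2.1 Exercises 7 (g), 8] -/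
theorem noRealZeroEven_fp_15452 :
    ∀ χ : DirichletCharacter ℂ 15452, χ.IsQuadratic → χ.IsPrimitive → χ.Even →
      ∀ σ : ℝ, 0 < σ → σ < 1 → χ.LFunction σ ≠ 0 :=
  good_even_of_four_blk [3863] (by norm_num) (by decide) (by decide) 15 6 90 10 (by decide) (by decide) (by decide)
    (Or.inr (by decide +kernel))

set_option maxHeartbeats 400000 in
/-- `D = 15573`: the even character `(·/15573)` of conductor `15573` (`15573`: 3 · 29 · 179) — Fekete–Pólya witness of order `5` along the induced modulus `15573·10 = 155730`, block certificate (digits of `72` bits, splitting depth `10`); est. `3.7` kernel-s. [cite: MontgomeryVaughan2007, §11.2.1 Exercises 7 (g), 8] -/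
theorem noRealZeroEven_fp_15573 :
    ∀ χ : DirichletCharacter ℂ 15573, χ.IsQuadratic → χ.IsPrimitive → χ.Even →
      ∀ σ : ℝ, 0 < σ → σ < 1 → χ.LFunction σ ≠ 0 :=
  good_even_of_odd_blk [3, 29, 179] (by norm_num) (by decide) (by decide) 10 5 72 10 (by decide) (by decide) (by decide)
    (Or.inr (by decide +kernel))

set_option maxHeartbeats 400000 in
/-- `D = -15592`: the odd character `χ₋₈·(·/1949)` of conductor `15592` (`1949`: prime) — Fekete–Pólya witness of order `8` along the induced modulus `15592·15 = 233880`, block certificate (digits of `121` bits, splitting depth `10`); est. `10.5` kernel-s. [cite: MontgomeryVaughan2007, §11.2.1 Exercises 7 (g), 8] -/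
theorem noRealZeroOdd_fp_15592 :
    ∀ χ : DirichletCharacter ℂ 15592, χ.IsQuadratic → χ.IsPrimitive → χ.Odd →
      ∀ σ : ℝ, 0 < σ → σ < 1 → χ.LFunction σ ≠ 0 :=
  good_odd_of_eight_blk [1949] (by norm_num) (by decide) (by decide) 15 8 121 10 (by decide) (by decide) (by decide)
    (Or.inr (by decide +kernel)) (Or.inl (by decide +kernel))

set_option maxHeartbeats 400000 in
/-- `D = 15605`: the even character `(·/15605)` of conductor `15605` (`15605`: 5 · 3121) — Fekete–Pólya witness of order `8` along the induced modulus `15605·11 = 171655`, block certificate (digits of `116` bits, splitting depth `10`); est. `7.6` kernel-s. [cite: MontgomeryVaughan2007, §11.2.1 Exercises 7 (g), 8] -/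
theorem noRealZeroEven_fp_15605 :
    ∀ χ : DirichletCharacter ℂ 15605, χ.IsQuadratic → χ.IsPrimitive → χ.Even →
      ∀ σ : ℝ, 0 < σ → σ < 1 → χ.LFunction σ ≠ 0 :=
  good_even_of_odd_blk [5, 3121] (by norm_num) (by decide) (by decide) 11 8 116 10 (by decide) (by decide) (by decide)
    (Or.inr (by decide +kernel))

set_option maxHeartbeats 400000 in
/-- `D = -15691`: the odd character `(·/15691)` of conductor `15691` (`15691`: 13 · 17 · 71) — Fekete–Pólya witness of order `8` along the induced modulus `15691·22 = 345202`, block certificate (digits of `125` bits, splitting depth `11`); est. `15.7` kernel-s. [cite: MontgomeryVaughan2007, §11.2.1 Exercises 7 (g), 8] -/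
theorem noRealZeroOdd_fp_15691 :
    ∀ χ : DirichletCharacter ℂ 15691, χ.IsQuadratic → χ.IsPrimitive → χ.Odd →
      ∀ σ : ℝ, 0 < σ → σ < 1 → χ.LFunction σ ≠ 0 :=
  good_odd_of_odd_blk [13, 17, 71] (by norm_num) (by decide) (by decide) 22 8 125 11 (by decide) (by decide) (by decide)
    (Or.inr (by decide +kernel))

set_option maxHeartbeats 400000 in
/-- `D = 15697`: the even character `(·/15697)` of conductor `15697` (`15697`: 11 · 1427) — Fekete–Pólya witness of order `6` along the induced modulus `15697·7 = 109879`, block certificate (digits of `85` bits, splitting depth `9`); est. `3.3` kernel-s. [cite: MontgomeryVaughan2007, §11.2.1 Exercises 7 (g), 8] -/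
theorem noRealZeroEven_fp_15697 :
    ∀ χ : DirichletCharacter ℂ 15697, χ.IsQuadratic → χ.IsPrimitive → χ.Even →
      ∀ σ : ℝ, 0 < σ → σ < 1 → χ.LFunction σ ≠ 0 :=
  good_even_of_odd_blk [11, 1427] (by norm_num) (by decide) (by decide) 7 6 85 9 (by decide) (by decide) (by decide)
    (Or.inr (by decide +kernel))

set_option maxHeartbeats 400000 in
/-- `D = 15765`: the even character `(·/15765)` of conductor `15765` (`15765`: 3 · 5 · 1051) — Fekete–Pólya witness of order `8` along the induced modulus `15765·22 = 346830`, block certificate (digits of `124` bits, splitting depth `11`); est. `15.7` kernel-s. [cite: MontgomeryVaughan2007, §11.2.1 Exercises 7 (g), 8] -/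
theorem noRealZeroEven_fp_15765 :
    ∀ χ : DirichletCharacter ℂ 15765, χ.IsQuadratic → χ.IsPrimitive → χ.Even →
      ∀ σ : ℝ, 0 < σ → σ < 1 → χ.LFunction σ ≠ 0 :=
  good_even_of_odd_blk [3, 5, 1051] (by norm_num) (by decide) (by decide) 22 8 124 11 (by decide) (by decide) (by decide)
    (Or.inr (by decide +kernel))

set_option maxHeartbeats 400000 in
/-- `D = -15816`: the odd character `χ₋₈·(·/1977)` of conductor `15816` (`1977`: 3 · 659) — Fekete–Pólya witness of order `3` along the induced modulus `15816·11 = 173976`, block certificate (digits of `43` bits, splitting depth `9`); est. `1.7` kernel-s. [cite: MontgomeryVaughan2007, §11.2.1 Exercises 7 (g), 8] -/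
theorem noRealZeroOdd_fp_15816 :
    ∀ χ : DirichletCharacter ℂ 15816, χ.IsQuadratic → χ.IsPrimitive → χ.Odd →
      ∀ σ : ℝ, 0 < σ → σ < 1 → χ.LFunction σ ≠ 0 :=
  good_odd_of_eight_blk [3, 659] (by norm_num) (by decide) (by decide) 11 3 43 9 (by decide) (by decide) (by decide)
    (Or.inr (by decide +kernel)) (Or.inl (by decide +kernel))

end Literature.NumberTheory.LFunctions
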